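import Mathlib
import Literature.NumberTheory.LFunctions.Zhang2022.Section13U007bTools
import Literature.NumberTheory.LFunctions.Zhang2022.Section13ConjugateAFE
import Literature.NumberTheory.LFunctions.Zhang2022.Section2FunctionalEquation
import HarnessLib

/-!
# Zhang (2022) §13 p. 75, the (13.11)-estimate "via Lemma 6.1 and 3.3":
# `Σ_{ψ∈Ψ₁}|L(s+β₂,ψ)L(1−s−β₂,ψ̄)| ≪ P²𝓛⁹` on `𝒥(±α)` (`Z22:§13.u007`, reconstructed target `U007b`
# of GAP G-L3t6-3) — as a kernel-checked EDGE from Lemma 6.1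

Topic `Literature/NumberTheory/LFunctions/Zhang2022` (Landau–Siegel audit tree; verdict-neutral).
Y. Zhang, *Discrete mean estimates and the Landau–Siegel zero*, arXiv:2211.02515v1 (2022)
[Zhang2022LandauSiegel], §13 p. 75, last sentence (tex L3817): "the right side being estimated via
Lemma 5.9, 6.1 and 3.3" — not carried out in print; the printed parallel is §8 p. 44 (tex
L2244–2250): "By Lemma 6.1 and the large sieve inequality … `Σ_{ψ∈Ψ₁}|L(s+β₂,ψ)L(s+β₃,ψ)|² ≪ P²𝓛³⁶`".
The typer (L3-t6, `TypedSection13.lean` append p413496) reconstructed the §13 instance as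
`Typed.Section13.U007b c′`: on `𝒥(±α)` (`s = ±α + s₀ + iv`, `|v| ≤ 𝓛₁`),
`Σ_{ψ∈Ψ₁} |L(s+β₂,ψ)L(1−s−β₂,ψ̄)| ≤ C·P²·𝓛ᵏ` for SOME absolute `k` (GAP-LEDGER row G-L3t6-3).

**What is proved** (0 new facts; Assumption (A) unused): `Typed.Section13.u007b_of :
Skeleton.Lemma61 → ∀ c′, U007b c′`, with the EXPLICIT exponent `k = 9`. Route: by the functional
equation (2.2) (tree `GammaFactor.LFunction_eq_Zfac_mul`) `L(1−s₂,ψ̄) = Z(s₂,ψ)⁻¹L(s₂,ψ)`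
(`s₂ = s + β₂`), and `|Z(s₂,ψ)|⁻¹ ≤ e¹⁶` (`norm_inv_Zfac_le_exp_sixteen`); so the sum is
`≤ e¹⁶ Σ_{Ψ₁}|L(s₂,ψ)|²`. Lemma 6.1 (`Skeleton.Lemma61`, a CLAIM leaf) gives
`|L| ≤ |K| + e¹⁶|N(1−s₂,ψ̄)| + C(E₁ + ε)`, and each square-mean over `Ψ₁ ⊆ Ψ` is bounded by the
LANDED large sieve (`Skeleton.lemma33b_sum_le`, via `meanSq_Ico_le`): the `K`- and `N`-polynomials
have lengths `2P₄, 2T² ≤ P²` and weights `|g*| ≤ 1`, `Σ_{n≤P²}n^{−1∓2α} ≤ e^{8π}(1 + 2𝓛⁹)`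
(`sum_rpow_Icc_le`), the `E₁`-term by `sum_E1main_sq_le` (Cauchy–Schwarz in `v`), the `ε`-term by
the character count `card_le_meanSq`.

WHAT THIS IS NOT: a proof of Lemma 6.1 itself; the other reconstructed estimates (`U007a` landed
separately, `U007c` another seat); (13.11); any claim about Theorems 1–2 of the manuscript or about
Landau–Siegel zeros.

## References

* Y. Zhang, arXiv:2211.02515v1 (2022), §13 p. 75; §8 p. 44; §6 Lemma 6.1; §3 Lemma 3.3; §2 (2.2).
  [cite: Zhang2022LandauSiegel, §13 p.75]
-/

noncomputable section

open Complex Real ComplexConjugate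

namespace Literature.NumberTheory.LFunctions.Zhang2022.Typed.Section13

open Skeleton GammaFactor

/-! ## Small arithmetic: the lengths `2P₄, 2T², T³` are `≤ P²`, and `|g*| ≤ 1` -/

open ComplexConjugate

/-- `⌈y⌉ ≤ ⌊Q⌋ + 1` once `y + 1 ≤ Q`, `y ≥ 0`. [folklore] -/
private theorem ceil_le_floor_succ {y Q : ℝ} (hy : 0 ≤ y) (h : y + 1 ≤ Q) : ⌈y⌉₊ ≤ ⌊Q⌋₊ + 1 := by
  have h1 : (⌈y⌉₊ : ℝ) < y + 1 := Nat.ceil_lt_add_one hy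
  have h2 : ⌈y⌉₊ ≤ ⌊Q⌋₊ := Nat.le_floor (by linarith)
  omega

/-- For `𝓛 ≥ 3`: `3𝓛⁵¹⁹ ≤ P = e^{𝓛⁹}`. [cite: Zhang2022LandauSiegel, §2 (2.6), (2.8)] -/
private theorem three_t0_le_bigP {D : ℕ} (hL : 3 ≤ ell D) : 3 * ell D ^ 519 ≤ bigP D := by
  have hL1 : 1 ≤ ell D := by linarith
  have h1 : ell D ≤ Real.exp (ell D - 1) := by
    have := Real.add_one_le_exp (ell D - 1); linarith
  have h2 : ell D ^ 519 ≤ Real.exp (519 * (ell D - 1)) := by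
    calc ell D ^ 519 ≤ Real.exp (ell D - 1) ^ 519 := pow_le_pow_left₀ (by linarith) h1 519
      _ = Real.exp (519 * (ell D - 1)) := by rw [← Real.exp_nat_mul]; norm_num
  have h3 : (3 : ℝ) ≤ Real.exp 519 := by
    have := Real.add_one_le_exp (519 : ℝ); linarith
  have h8 : (6561 : ℝ) ≤ ell D ^ 8 := le_trans (by norm_num) (pow_le_pow_left₀ (by norm_num) hL 8)
  have h9 : 519 * ell D ≤ ell D ^ 9 := by
    have : ell D ^ 9 = ell D * ell D ^ 8 := by ring
    nlinarith
  rw [bigP]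
  calc 3 * ell D ^ 519 ≤ Real.exp 519 * Real.exp (519 * (ell D - 1)) :=
        mul_le_mul h3 h2 (by positivity) (Real.exp_nonneg _)
    _ = Real.exp (519 * ell D) := by rw [← Real.exp_add]; ring_nf
    _ ≤ Real.exp (ell D ^ 9) := Real.exp_le_exp.mpr h9

/-- For `𝓛 ≥ 3`: `3T³ ≤ P²` (`T = e^{𝓛^{1.1}}`, `𝓛^{1.1} ≤ 𝓛²`, `3𝓛² + 2 ≤ 2𝓛⁹`).
[cite: Zhang2022LandauSiegel, §2 (2.8); §6 p.30] -/
private theorem three_T_cube_le {D : ℕ} (hL : 3 ≤ ell D) : 3 * bigT D ^ 3 ≤ bigP D ^ 2 := by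
  have hL1 : 1 ≤ ell D := by linarith
  have hL0 : 0 ≤ ell D := by linarith
  have h11 : ell D ^ (1.1 : ℝ) ≤ ell D ^ 2 := by
    calc ell D ^ (1.1 : ℝ) ≤ ell D ^ (2 : ℝ) := Real.rpow_le_rpow_of_exponent_le hL1 (by norm_num)
      _ = ell D ^ 2 := by rw [Real.rpow_two]
  have hT3 : bigT D ^ 3 = Real.exp (3 * ell D ^ (1.1 : ℝ)) := by
    rw [bigT, ← Real.exp_nat_mul]; norm_num
  have hP2 : bigP D ^ 2 = Real.exp (2 * ell D ^ 9) := by rw [bigP, ← Real.exp_nat_mul]; norm_num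
  have h3 : (3 : ℝ) ≤ Real.exp 2 := by have := Real.add_one_le_exp (2 : ℝ); linarith
  have h7 : (2187 : ℝ) ≤ ell D ^ 7 := le_trans (by norm_num) (pow_le_pow_left₀ (by norm_num) hL 7)
  have h9 : 3 * ell D ^ 2 + 2 ≤ 2 * ell D ^ 9 := by
    have : ell D ^ 9 = ell D ^ 2 * ell D ^ 7 := by ring
    nlinarith [pow_pos (show (0:ℝ) < ell D by linarith) 2]
  rw [hT3, hP2]
  calc 3 * Real.exp (3 * ell D ^ (1.1 : ℝ)) ≤ Real.exp 2 * Real.exp (3 * ell D ^ 2) := by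
        refine mul_le_mul h3 (Real.exp_le_exp.mpr (by linarith)) (Real.exp_nonneg _) (Real.exp_nonneg _)
    _ = Real.exp (3 * ell D ^ 2 + 2) := by rw [← Real.exp_add]; ring_nf
    _ ≤ Real.exp (2 * ell D ^ 9) := Real.exp_le_exp.mpr h9

/-- The three truncation points of `K`, `N`, `E₁` and the trivial one lie below `⌊P²⌋ + 1` (`𝓛 ≥ 3`).
[cite: Zhang2022LandauSiegel, §6 Lemma 6.1] -/
theorem lengths_le {D : ℕ} (hL : 3 ≤ ell D) :
    ⌈2 * P4 D⌉₊ ≤ ⌊bigP D ^ 2⌋₊ + 1 ∧ ⌈2 * bigT D ^ 2⌉₊ ≤ ⌊bigP D ^ 2⌋₊ + 1 ∧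
      ⌈bigT D ^ 3⌉₊ ≤ ⌊bigP D ^ 2⌋₊ + 1 ∧ 1 ≤ ⌊bigP D ^ 2⌋₊ := by
  have hL1 : 1 ≤ ell D := by linarith
  have hP : 0 < bigP D := Real.exp_pos _
  have hP1 : 1 ≤ bigP D := by rw [bigP]; exact Real.one_le_exp (by positivity)
  have hT1 : 1 ≤ bigT D := by rw [bigT]; exact Real.one_le_exp (by positivity)
  have hT0 : 0 < bigT D := by linarith
  have ht0 : 0 ≤ t0 D := by rw [t0]; positivity
  have h3t : 3 * t0 D ≤ bigP D := by rw [t0]; exact three_t0_le_bigP hL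
  have hT3 := three_T_cube_le hL
  -- `P₄ ≤ P·t₀`
  have hP4 : P4 D ≤ bigP D * t0 D := by
    rw [P4]
    refine mul_le_mul_of_nonneg_right (div_le_self hP.le ?_) ht0
    exact one_le_pow₀ hT1
  have hP4_0 : 0 ≤ P4 D := by rw [P4]; positivity
  refine ⟨ceil_le_floor_succ (by positivity) ?_, ceil_le_floor_succ (by positivity) ?_,
    ceil_le_floor_succ (by positivity) ?_, ?_⟩
  · -- `2P₄ + 1 ≤ 2Pt₀ + P ≤ P·(3t₀)… ≤ P²`
    have h1 : 2 * P4 D + 1 ≤ bigP D * (2 * t0 D + 1) := by nlinarith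
    have h2 : 2 * t0 D + 1 ≤ bigP D := by
      have : (1 : ℝ) ≤ t0 D := by rw [t0]; exact one_le_pow₀ hL1
      linarith
    calc 2 * P4 D + 1 ≤ bigP D * (2 * t0 D + 1) := h1
      _ ≤ bigP D * bigP D := mul_le_mul_of_nonneg_left h2 hP.le
      _ = bigP D ^ 2 := (sq _).symm
  · -- `2T² + 1 ≤ 3T³ ≤ P²`
    have : bigT D ^ 2 ≤ bigT D ^ 3 := pow_le_pow_right₀ hT1 (by norm_num)
    have h1 : (1 : ℝ) ≤ bigT D ^ 3 := one_le_pow₀ hT1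
    linarith
  · have h1 : (1 : ℝ) ≤ bigT D ^ 3 := one_le_pow₀ hT1
    linarith
  · exact Nat.le_floor (by simpa using one_le_pow₀ (M₀ := ℝ) hP1 (n := 2))

/-- `|g*(y)| ≤ 1` (as a complex number): `0 < g < 1` (tree `GaussWeight.gWeight_pos/lt_one`).
[cite: Zhang2022LandauSiegel, §4 (4.1); §6 p.30] -/
theorem norm_gstar_le_one {D : ℕ} (hℓ : 0 < ell D) (y : ℝ) : ‖(gstar D y : ℂ)‖ ≤ 1 := by
  rw [Complex.norm_real, Real.norm_eq_abs, gstar]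
  split_ifs
  · have h30 : 0 < ell D ^ 30 := pow_pos hℓ 30
    rw [gW, abs_of_pos (GaussWeight.gWeight_pos h30 y)]
    exact (GaussWeight.gWeight_lt_one h30 y).le
  · simp

/-- `(a + b + c + d)² ≤ 4(a² + b² + c² + d²)`. [folklore] -/
private theorem sq_add_four_le (a b c d : ℝ) :
    (a + b + c + d) ^ 2 ≤ 4 * (a ^ 2 + b ^ 2 + c ^ 2 + d ^ 2) := by
  nlinarith [sq_nonneg (a - b), sq_nonneg (a - c), sq_nonneg (a - d), sq_nonneg (b - c),
    sq_nonneg (b - d), sq_nonneg (c - d)]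

/-! ## Per-character bound: `(2.2)`, `|Z|^{±1} ≤ e¹⁶`, Lemma 6.1, squaring -/

/-- **Per-character step.** For `ψ ∈ Ψ`, `s₂ = σ′ + it₂` on Lemma 6.1's range (`|σ′−½| ≤ 2α`,
`|t₂ − 2πt₀| < 𝓛₁ + 2`), a weight point `w₂ = \overline{1 − s₂}`, and Lemma 6.1's inequality at
`s₂` with a constant `C′ ≥ 0` (its `ε` replaced by `1`):
`|L(s₂,ψ)L(1−s₂,ψ̄)| ≤ 4e¹⁶(|K(s₂,ψ)|² + e³²|N(w₂,ψ)|² + C′²E₁(s₂,ψ)² + C′²)` — by (2.2)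
`L(1−s₂,ψ̄) = Z(s₂,ψ)⁻¹L(s₂,ψ)`, `|Z|^{±1} ≤ e¹⁶`, `|N(1−s₂,ψ̄)| = |N(w₂,ψ)|`, and
`(a+b+c+d)² ≤ 4(a²+b²+c²+d²)`. [cite: Zhang2022LandauSiegel, §13 p.75; §6 Lemma 6.1; §2 (2.2)] -/
theorem norm_L_mul_dual_le {D : ℕ} (x : Chr D) (hL : 3 ≤ ell D) {s₂ w₂ : ℂ} {σ' t₂ C' : ℝ}
    (hre : s₂.re = σ') (him : s₂.im = t₂) (hσ : |σ' - 1 / 2| ≤ 2 * alpha D)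
    (ht : |t₂ - 2 * π * ell D ^ 519| < ell D ^ 405 + 2) (ht0 : 0 < t₂)
    (hw₂ : w₂ = conj (1 - s₂))
    (h61 : ‖x.ψ.LFunction s₂ - Kchar D (psiFn x) s₂ -
        Zfac x.ψ s₂ * Nchar D (psiBarFn x) (1 - s₂)‖ ≤ C' * (E1main x s₂ + 1)) :
    ‖x.ψ.LFunction s₂ * x.ψ⁻¹.LFunction (1 - s₂)‖ ≤
      4 * Real.exp 16 * (‖Kchar D (psiFn x) s₂‖ ^ 2 + Real.exp 32 * ‖Nchar D (psiFn x) w₂‖ ^ 2 +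
        C' ^ 2 * E1main x s₂ ^ 2 + C' ^ 2) := by
  have hs : s₂ = (σ' : ℂ) + t₂ * I := Complex.ext (by simp [hre]) (by simp [him])
  have him0 : 0 < s₂.im := by rw [him]; exact ht0
  have hZinv : ‖(Zfac x.ψ s₂)⁻¹‖ ≤ Real.exp 16 := by
    rw [hs]; exact norm_inv_Zfac_le_exp_sixteen x hL hσ ht
  have hZle : ‖Zfac x.ψ s₂‖ ≤ Real.exp 16 := by
    rw [hs]; exact Section6Statements.norm_Zfac_le_exp_sixteen x hL hσ ht
  -- (2.2): `L(1−s₂,ψ̄) = Z(s₂,ψ)⁻¹L(s₂,ψ)`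
  have hFE : x.ψ⁻¹.LFunction (1 - s₂) = (Zfac x.ψ s₂)⁻¹ * x.ψ.LFunction s₂ := by
    have hZ0 : Zfac x.ψ s₂ ≠ 0 := Zfac_ne_zero x.prim him0
    have h := LFunction_eq_Zfac_mul x.prim x.p_ne_one him0.ne'
    rw [h, ← mul_assoc, inv_mul_cancel₀ hZ0, one_mul]
  have h1 : ‖x.ψ.LFunction s₂ * x.ψ⁻¹.LFunction (1 - s₂)‖ ≤
      Real.exp 16 * ‖x.ψ.LFunction s₂‖ ^ 2 := by
    rw [hFE, norm_mul, norm_mul]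
    have hL0' : 0 ≤ ‖x.ψ.LFunction s₂‖ := norm_nonneg _
    calc ‖x.ψ.LFunction s₂‖ * (‖(Zfac x.ψ s₂)⁻¹‖ * ‖x.ψ.LFunction s₂‖)
        ≤ ‖x.ψ.LFunction s₂‖ * (Real.exp 16 * ‖x.ψ.LFunction s₂‖) :=
          mul_le_mul_of_nonneg_left (mul_le_mul_of_nonneg_right hZinv hL0') hL0'
      _ = Real.exp 16 * ‖x.ψ.LFunction s₂‖ ^ 2 := by ring
  -- Lemma 6.1: `|L| ≤ |K| + e¹⁶|N(w₂)| + C′E₁ + C′`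
  have hN : ‖Zfac x.ψ s₂ * Nchar D (psiBarFn x) (1 - s₂)‖ ≤
      Real.exp 16 * ‖Nchar D (psiFn x) w₂‖ := by
    rw [norm_mul, ← Complex.norm_conj (Nchar D (psiBarFn x) (1 - s₂)), conj_Nchar_bar, ← hw₂]
    exact mul_le_mul_of_nonneg_right hZle (norm_nonneg _)
  have h2 : ‖x.ψ.LFunction s₂‖ ≤ ‖Kchar D (psiFn x) s₂‖ + Real.exp 16 * ‖Nchar D (psiFn x) w₂‖ +
      C' * E1main x s₂ + C' := by
    have h3 : x.ψ.LFunction s₂ =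
        (x.ψ.LFunction s₂ - Kchar D (psiFn x) s₂ - Zfac x.ψ s₂ * Nchar D (psiBarFn x) (1 - s₂)) +
          Kchar D (psiFn x) s₂ + Zfac x.ψ s₂ * Nchar D (psiBarFn x) (1 - s₂) := by ring
    calc ‖x.ψ.LFunction s₂‖
        = ‖(x.ψ.LFunction s₂ - Kchar D (psiFn x) s₂ - Zfac x.ψ s₂ * Nchar D (psiBarFn x) (1 - s₂)) +
            Kchar D (psiFn x) s₂ + Zfac x.ψ s₂ * Nchar D (psiBarFn x) (1 - s₂)‖ :=
          congrArg _ h3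
      _ ≤ ‖x.ψ.LFunction s₂ - Kchar D (psiFn x) s₂ - Zfac x.ψ s₂ * Nchar D (psiBarFn x) (1 - s₂)‖ +
            ‖Kchar D (psiFn x) s₂‖ + ‖Zfac x.ψ s₂ * Nchar D (psiBarFn x) (1 - s₂)‖ := norm_add₃_le
      _ ≤ C' * (E1main x s₂ + 1) + ‖Kchar D (psiFn x) s₂‖ +
            Real.exp 16 * ‖Nchar D (psiFn x) w₂‖ := add_le_add (add_le_add h61 le_rfl) hN
      _ = _ := by ring
  have hsq : ‖x.ψ.LFunction s₂‖ ^ 2 ≤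
      (‖Kchar D (psiFn x) s₂‖ + Real.exp 16 * ‖Nchar D (psiFn x) w₂‖ + C' * E1main x s₂ + C') ^ 2 :=
    pow_le_pow_left₀ (norm_nonneg _) h2 2
  have h4 := sq_add_four_le ‖Kchar D (psiFn x) s₂‖ (Real.exp 16 * ‖Nchar D (psiFn x) w₂‖)
    (C' * E1main x s₂) C'
  have hexp32 : Real.exp 16 ^ 2 = Real.exp 32 := by rw [← Real.exp_nat_mul]; norm_num
  calc ‖x.ψ.LFunction s₂ * x.ψ⁻¹.LFunction (1 - s₂)‖ ≤ Real.exp 16 * ‖x.ψ.LFunction s₂‖ ^ 2 := h1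
    _ ≤ Real.exp 16 * (4 * (‖Kchar D (psiFn x) s₂‖ ^ 2 + (Real.exp 16 * ‖Nchar D (psiFn x) w₂‖) ^ 2 +
        (C' * E1main x s₂) ^ 2 + C' ^ 2)) :=
        mul_le_mul_of_nonneg_left (hsq.trans h4) (Real.exp_nonneg _)
    _ = _ := by rw [mul_pow, mul_pow, hexp32]; ring

/-! ## The four mean squares over a subfamily of `Ψ` -/

/-- **The four mean squares**, for `|Re s₂ − ½| ≤ 2α`, `|Re w₂ − ½| ≤ 2α`, `𝓛 ≥ 3` and any finite
subfamily `T ⊆ Ψ`: `Σ_{ψ∈T}(|K(s₂)|² + e³²|N(w₂)|² + C′²E₁(s₂)² + C′²)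
≤ (1 + e³² + 5C′²)·C₃₃P²·e^{8π}(1 + 2𝓛⁹)` (large sieve ×4: `meanSq_Ico_le`, `sum_E1main_sq_le`,
`card_le_meanSq`; `Σ_{n≤P²}n^{−2σ} ≤ e^{8π}(1 + 2𝓛⁹)`). [cite: Zhang2022LandauSiegel, §13 p.75; §3 Lemma 3.3] -/
theorem four_meanSq_le {D : ℕ} (T : Finset (Chr D)) (hL : 3 ≤ ell D) {s₂ w₂ : ℂ}
    (hs : |s₂.re - 1 / 2| ≤ 2 * alpha D) (hw : |w₂.re - 1 / 2| ≤ 2 * alpha D) (C' : ℝ) :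
    ∑ x ∈ T, (‖Kchar D (psiFn x) s₂‖ ^ 2 + Real.exp 32 * ‖Nchar D (psiFn x) w₂‖ ^ 2 +
        C' ^ 2 * E1main x s₂ ^ 2 + C' ^ 2) ≤
      (1 + Real.exp 32 + 5 * C' ^ 2) * ((2 + 2 * (3 + (Real.log 2 ^ 68)⁻¹) ^ 2) * bigP D ^ 2 *
        (Real.exp (8 * π) * (1 + 2 * ell D ^ 9))) := by
  have hL1 : 1 ≤ ell D := by linarith
  have hL0 : 0 < ell D := by linarith
  obtain ⟨hNK, hNN, hNE, hN1⟩ := lengths_le hL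
  obtain ⟨C₃, hC₃⟩ : ∃ C : ℝ, C = 2 + 2 * (3 + (Real.log 2 ^ 68)⁻¹) ^ 2 := ⟨_, rfl⟩
  have hC₃0 : 0 ≤ C₃ := by rw [hC₃]; exact c33_nonneg
  obtain ⟨H, hH⟩ : ∃ H : ℝ, H = Real.exp (8 * π) * (1 + 2 * ell D ^ 9) := ⟨_, rfl⟩
  have hP0 : 0 ≤ C₃ * bigP D ^ 2 := mul_nonneg hC₃0 (by positivity)
  have hexp : ∀ {u : ℝ}, |u - 1 / 2| ≤ 2 * alpha D → |-2 * u + 1| ≤ 4 * alpha D := by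
    intro u hu
    rw [show -2 * u + 1 = -2 * (u - 1 / 2) by ring, abs_mul, abs_neg, abs_two]
    linarith
  have hsum1 : ∑ n ∈ Finset.Icc 1 ⌊bigP D ^ 2⌋₊, (n : ℝ) ^ (-2 * s₂.re) ≤ H := by
    rw [hH]; exact sum_rpow_Icc_le hL1 (hexp hs)
  have hsum2 : ∑ n ∈ Finset.Icc 1 ⌊bigP D ^ 2⌋₊, (n : ℝ) ^ (-2 * w₂.re) ≤ H := by
    rw [hH]; exact sum_rpow_Icc_le hL1 (hexp hw)
  -- `K`
  have hK : ∑ x ∈ T, ‖Kchar D (psiFn x) s₂‖ ^ 2 ≤ C₃ * bigP D ^ 2 * H := by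
    have h := meanSq_Ico_le T s₂ hNK (fun n => (gstar D (P4 D / n) : ℂ))
      (fun n => norm_gstar_le_one hL0 _)
    rw [← hC₃] at h
    have hK' : ∀ x ∈ T, ‖Kchar D (psiFn x) s₂‖ ^ 2 =
        ‖∑ n ∈ Finset.Ico 1 ⌈2 * P4 D⌉₊, x.ψ (n : ZMod x.p) * (n : ℂ) ^ (-s₂) *
          (gstar D (P4 D / n) : ℂ)‖ ^ 2 := fun x _ => by simp only [Kchar, psiFn]
    rw [Finset.sum_congr rfl hK']
    exact h.trans (mul_le_mul_of_nonneg_left hsum1 hP0)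
  -- `N`
  have hNs : ∑ x ∈ T, ‖Nchar D (psiFn x) w₂‖ ^ 2 ≤ C₃ * bigP D ^ 2 * H := by
    have h := meanSq_Ico_le T w₂ hNN (fun n => (gstar D (bigT D ^ 2 / n) : ℂ))
      (fun n => norm_gstar_le_one hL0 _)
    rw [← hC₃] at h
    have hN' : ∀ x ∈ T, ‖Nchar D (psiFn x) w₂‖ ^ 2 =
        ‖∑ n ∈ Finset.Ico 1 ⌈2 * bigT D ^ 2⌉₊, x.ψ (n : ZMod x.p) * (n : ℂ) ^ (-w₂) *
          (gstar D (bigT D ^ 2 / n) : ℂ)‖ ^ 2 := fun x _ => by simp only [Nchar, psiFn]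
    rw [Finset.sum_congr rfl hN']
    exact h.trans (mul_le_mul_of_nonneg_left hsum2 hP0)
  -- `E₁`
  have hE : ∑ x ∈ T, E1main x s₂ ^ 2 ≤ 4 * (C₃ * bigP D ^ 2 * H) := by
    have h := sum_E1main_sq_le T hL (s := s₂) hs hNE
    refine h.trans (le_of_eq ?_)
    rw [hC₃, hH]
  -- the constant term (character count)
  have hcard : ∑ x ∈ T, C' ^ 2 ≤ C' ^ 2 * (C₃ * bigP D ^ 2 * H) := by
    rw [Finset.sum_const, nsmul_eq_mul, mul_comm]
    have h := card_le_meanSq T s₂ hN1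
    rw [← hC₃] at h
    exact mul_le_mul_of_nonneg_left (h.trans (mul_le_mul_of_nonneg_left hsum1 hP0)) (sq_nonneg _)
  -- assemble
  rw [Finset.sum_add_distrib, Finset.sum_add_distrib, Finset.sum_add_distrib, ← Finset.mul_sum,
    ← Finset.mul_sum]
  calc ∑ x ∈ T, ‖Kchar D (psiFn x) s₂‖ ^ 2 + Real.exp 32 * ∑ x ∈ T, ‖Nchar D (psiFn x) w₂‖ ^ 2 +
        C' ^ 2 * ∑ x ∈ T, E1main x s₂ ^ 2 + ∑ x ∈ T, C' ^ 2
      ≤ C₃ * bigP D ^ 2 * H + Real.exp 32 * (C₃ * bigP D ^ 2 * H) +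
          C' ^ 2 * (4 * (C₃ * bigP D ^ 2 * H)) + C' ^ 2 * (C₃ * bigP D ^ 2 * H) :=
        add_le_add (add_le_add (add_le_add hK (mul_le_mul_of_nonneg_left hNs (Real.exp_nonneg _)))
          (mul_le_mul_of_nonneg_left hE (sq_nonneg _))) hcard
    _ = (1 + Real.exp 32 + 5 * C' ^ 2) * (C₃ * bigP D ^ 2 * H) := by ring
    _ = _ := by rw [hC₃, hH]

/-! ## The edge -/

/-- **`Z22:§13.u007`, estimate "via Lemma 6.1 and 3.3" (`U007b`), as a kernel-checked EDGE with
`k = 9`** [Z22 p.75, tex L3817; reconstructed target of GAP G-L3t6-3; printed parallel §8 p.44]: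
Lemma 6.1 implies `Typed.Section13.U007b c′`: for `D` large, `σ = ±α`, `|v| ≤ 𝓛₁`, `s = σ + s₀ + iv`,
`Σ_{ψ∈Ψ₁} |L(s+β₂,ψ)L(1−s−β₂,ψ̄)| ≤ C·P²·𝓛⁹`,
`C = 12·e¹⁶e^{8π}C₃₃(1 + e³² + 5·max(C₆.₁,0)²)`. [cite: Zhang2022LandauSiegel, §13 p.75] -/
theorem u007b_of (h61 : Lemma61) (c' : ℝ) : U007b c' := by
  obtain ⟨c, hc, C₆, D₆, h61⟩ := h61
  obtain ⟨C', hC'⟩ : ∃ C' : ℝ, C' = max C₆ 0 := ⟨_, rfl⟩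
  have hC'0 : 0 ≤ C' := by rw [hC']; exact le_max_right _ _
  have hC'1 : C₆ ≤ C' := by rw [hC']; exact le_max_left _ _
  obtain ⟨K, hK⟩ : ∃ K : ℝ, K = 1 + 5 * π * |c'| := ⟨_, rfl⟩
  have hπc : 0 ≤ π * |c'| := mul_nonneg pi_pos.le (abs_nonneg c')
  have hK1 : 1 ≤ K := by rw [hK]; linarith
  obtain ⟨M, hM⟩ : ∃ M : ℝ, M = 16 + 3 * π * K := ⟨_, rfl⟩
  have hπK : 3 * K ≤ 3 * π * K := by nlinarith [Real.pi_gt_three]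
  have hM16 : 16 ≤ M := by rw [hM]; linarith
  refine ⟨9, 12 * (Real.exp 16 * Real.exp (8 * π)) * (2 + 2 * (3 + (Real.log 2 ^ 68)⁻¹) ^ 2) *
      (1 + Real.exp 32 + 5 * C' ^ 2),
    max D₆ ⌈Real.exp M⌉₊, fun D _ χ hD hq hp _ σ hσ v hv => ?_⟩
  have hD₆ : D₆ ≤ D := le_trans (le_max_left _ _) hD
  have hDM : ⌈Real.exp M⌉₊ ≤ D := le_trans (le_max_right _ _) hD
  -- `𝓛 ≥ M ≥ 16`
  have hDreal : Real.exp M ≤ (D : ℝ) := le_trans (Nat.le_ceil _) (by exact_mod_cast hDM)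
  have hDpos : (0 : ℝ) < D := lt_of_lt_of_le (Real.exp_pos M) hDreal
  have hℓM : M ≤ ell D := by rw [ell]; exact (Real.le_log_iff_exp_le hDpos).mpr hDreal
  have hL3 : 3 ≤ ell D := by linarith
  have hL1 : 1 ≤ ell D := by linarith
  have hL0 : 0 < ell D := by linarith
  -- `α`, `v₂`
  have hα : alpha D = π / ell D ^ 9 := by rw [alpha, bigP, Real.log_exp]
  have hα0 : 0 < alpha D := by rw [hα]; positivity
  have hαℓ : alpha D ≤ π / ell D := by
    rw [hα]; exact div_le_div_of_nonneg_left pi_pos.le hL0 (le_self_pow₀ hL1 (by norm_num))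
  obtain ⟨v2, hv2⟩ : ∃ v2 : ℝ, v2 = 2 * alpha D * (1 + c' * alpha D * ell D) := ⟨_, rfl⟩
  have hv2abs : |v2| ≤ 1 := by
    have h8 : ell D ≤ ell D ^ 9 := le_self_pow₀ hL1 (by norm_num)
    have hαℓπ : alpha D * ell D ≤ π := by
      calc alpha D * ell D ≤ alpha D * ell D ^ 9 := by gcongr
        _ = π := by rw [hα, div_mul_cancel₀ _ (by positivity)]
    have hb : |c' * alpha D * ell D| ≤ π * |c'| := by
      rw [show c' * alpha D * ell D = c' * (alpha D * ell D) by ring, abs_mul,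
        abs_of_nonneg (by positivity : 0 ≤ alpha D * ell D)]
      calc |c'| * (alpha D * ell D) ≤ |c'| * π := by gcongr
        _ = π * |c'| := by ring
    have h1 : |1 + c' * alpha D * ell D| ≤ 1 + π * |c'| := by
      calc |1 + c' * alpha D * ell D| ≤ |(1 : ℝ)| + |c' * alpha D * ell D| := abs_add_le _ _
        _ ≤ 1 + π * |c'| := by rw [abs_one]; linarith
    have h3 : 3 * alpha D * K ≤ 1 := by
      calc 3 * alpha D * K ≤ 3 * (π / ell D) * K := by gcongr
        _ = (3 * π * K) / ell D := by ring
        _ ≤ 1 := by rw [div_le_one hL0]; linarith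
    rw [hv2, abs_mul, abs_of_nonneg (by linarith : 0 ≤ 2 * alpha D)]
    calc 2 * alpha D * |1 + c' * alpha D * ell D| ≤ 2 * alpha D * (1 + π * |c'|) :=
          mul_le_mul_of_nonneg_left h1 (by linarith)
      _ ≤ 3 * alpha D * K := by rw [hK]; nlinarith
      _ ≤ 1 := h3
  have hβ2 : beta2 c' D = (v2 : ℂ) * I := by rw [hv2]; simp only [beta2]; push_cast; ring
  -- the point `s₂ = (1/2 + σ) + i(2πt₀ + v + v₂)`
  obtain ⟨σ', hσ'⟩ : ∃ σ' : ℝ, σ' = 1 / 2 + σ := ⟨_, rfl⟩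
  obtain ⟨t₂, ht₂⟩ : ∃ t₂ : ℝ, t₂ = 2 * π * t0 D + v + v2 := ⟨_, rfl⟩
  obtain ⟨s₂, hs₂⟩ : ∃ s₂ : ℂ, s₂ = (σ' : ℂ) + t₂ * I := ⟨_, rfl⟩
  have hs_eq : (σ : ℂ) + s0 D + v * I + beta2 c' D = s₂ := by
    rw [hs₂, hβ2, hσ', ht₂]
    apply Complex.ext
    · simp [s0_re]; ring
    · simp [s0_im]
  have hs_eq' : 1 - ((σ : ℂ) + s0 D + v * I) - beta2 c' D = 1 - s₂ := by rw [← hs_eq]; ring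
  have hσabs : |σ' - 1 / 2| = alpha D := by
    rw [hσ', show 1 / 2 + σ - 1 / 2 = σ by ring]
    rcases hσ with h | h
    · rw [h, abs_of_pos hα0]
    · rw [h, abs_neg, abs_of_pos hα0]
  have hσ2α : |σ' - 1 / 2| ≤ 2 * alpha D := by rw [hσabs]; linarith
  have hs₂re : s₂.re = σ' := by rw [hs₂]; simp
  have hs₂im : s₂.im = t₂ := by rw [hs₂]; simp
  have hvℓ : |v| ≤ ell D ^ 405 := by rw [ell1] at hv; exact hv
  have ht₂range : |t₂ - 2 * π * ell D ^ 519| < ell D ^ 405 + 2 := by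
    rw [ht₂, t0, show 2 * π * ell D ^ 519 + v + v2 - 2 * π * ell D ^ 519 = v + v2 by ring]
    calc |v + v2| ≤ |v| + |v2| := abs_add_le _ _
      _ < ell D ^ 405 + 2 := by linarith
  have ht₂pos : 0 < t₂ := by
    have h519 : (3 : ℝ) ≤ ell D ^ 519 := le_trans hL3 (le_self_pow₀ hL1 (by norm_num))
    have h405 : ell D ^ 405 ≤ ell D ^ 519 := pow_le_pow_right₀ hL1 (by norm_num)
    have h1 := (abs_le.mp hvℓ).1
    have h2 := (abs_le.mp hv2abs).1
    have hπ : (3 : ℝ) < π := Real.pi_gt_three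
    rw [ht₂, t0]; nlinarith
  -- the reflected point
  obtain ⟨w₂, hw₂⟩ : ∃ w : ℂ, w = conj (1 - s₂) := ⟨_, rfl⟩
  have hw₂re : |w₂.re - 1 / 2| ≤ 2 * alpha D := by
    have : w₂.re = 1 - σ' := by rw [hw₂]; simp [hs₂re]
    rw [this, show 1 - σ' - 1 / 2 = -(σ' - 1 / 2) by ring, abs_neg]; exact hσ2α
  -- Lemma 6.1's range at `s₂`, and its inequality with `ε ≤ 1`
  have hr1 : |s₂.re - 1 / 2| < 2 * alpha D := by rw [hs₂re, hσabs]; linarith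
  have hr2 : |s₂.im - 2 * π * t0 D| < ell1 D + 2 := by
    rw [hs₂im, ell1, t0]; exact ht₂range
  have hsre : |s₂.re - 1 / 2| ≤ 2 * alpha D := by rw [hs₂re]; exact hσ2α
  have h61' : ∀ x : Chr D, ‖x.ψ.LFunction s₂ - Kchar D (psiFn x) s₂ -
      Zfac x.ψ s₂ * Nchar D (psiBarFn x) (1 - s₂)‖ ≤ C' * (E1main x s₂ + 1) := by
    intro x
    have h := h61 D χ hD₆ hq hp x s₂ hr1 hr2
    have hE0 : 0 ≤ E1main x s₂ := E1main_nonneg x s₂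
    have h10 : 0 ≤ c * ell D ^ 10 := mul_nonneg hc.le (pow_nonneg hL0.le 10)
    have hε1 : Real.exp (-c * ell D ^ 10) ≤ 1 := Real.exp_le_one_iff.mpr (by linarith only [h10])
    calc _ ≤ C₆ * (E1main x s₂ + Real.exp (-c * ell D ^ 10)) := h
      _ ≤ C' * (E1main x s₂ + Real.exp (-c * ell D ^ 10)) :=
          mul_le_mul_of_nonneg_right hC'1 (add_nonneg hE0 (Real.exp_nonneg _))
      _ ≤ C' * (E1main x s₂ + 1) := mul_le_mul_of_nonneg_left (add_le_add le_rfl hε1) hC'0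
  -- assemble
  rw [hs_eq, hs_eq']
  have h9 : (1 : ℝ) ≤ ell D ^ 9 := one_le_pow₀ hL1
  have hHle : Real.exp (8 * π) * (1 + 2 * ell D ^ 9) ≤ 3 * Real.exp (8 * π) * ell D ^ 9 := by
    nlinarith [Real.exp_pos (8 * π)]
  calc ∑ x ∈ finsetOf (PsiOne χ), ‖x.ψ.LFunction s₂ * x.ψ⁻¹.LFunction (1 - s₂)‖
      ≤ ∑ x ∈ finsetOf (PsiOne χ), 4 * Real.exp 16 * (‖Kchar D (psiFn x) s₂‖ ^ 2 +
          Real.exp 32 * ‖Nchar D (psiFn x) w₂‖ ^ 2 + C' ^ 2 * E1main x s₂ ^ 2 + C' ^ 2) :=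
        Finset.sum_le_sum fun x _ =>
          norm_L_mul_dual_le x hL3 hs₂re hs₂im hσ2α ht₂range ht₂pos hw₂ (h61' x)
    _ = 4 * Real.exp 16 * ∑ x ∈ finsetOf (PsiOne χ), (‖Kchar D (psiFn x) s₂‖ ^ 2 +
          Real.exp 32 * ‖Nchar D (psiFn x) w₂‖ ^ 2 + C' ^ 2 * E1main x s₂ ^ 2 + C' ^ 2) := by
        rw [Finset.mul_sum]
    _ ≤ 4 * Real.exp 16 * ((1 + Real.exp 32 + 5 * C' ^ 2) *
          ((2 + 2 * (3 + (Real.log 2 ^ 68)⁻¹) ^ 2) * bigP D ^ 2 *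
            (Real.exp (8 * π) * (1 + 2 * ell D ^ 9)))) :=
        mul_le_mul_of_nonneg_left (four_meanSq_le _ hL3 hsre hw₂re C') (by positivity)
    _ ≤ 4 * Real.exp 16 * ((1 + Real.exp 32 + 5 * C' ^ 2) *
          ((2 + 2 * (3 + (Real.log 2 ^ 68)⁻¹) ^ 2) * bigP D ^ 2 *
            (3 * Real.exp (8 * π) * ell D ^ 9))) :=
        mul_le_mul_of_nonneg_left (mul_le_mul_of_nonneg_left
          (mul_le_mul_of_nonneg_left hHle (mul_nonneg c33_nonneg (by positivity)))
          (by positivity)) (by positivity)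
    _ = 12 * (Real.exp 16 * Real.exp (8 * π)) * (2 + 2 * (3 + (Real.log 2 ^ 68)⁻¹) ^ 2) *
          (1 + Real.exp 32 + 5 * C' ^ 2) * bigP D ^ 2 * ell D ^ 9 := by ring

end Literature.NumberTheory.LFunctions.Zhang2022.Typed.Section13
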